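import Summits.AtomisticToContinuum.BoseEinsteinCondensation.Theorems.BECGroundStateSOSPeriodicIRBoundFsumDCPotAdj
import Summits.AtomisticToContinuum.BoseEinsteinCondensation.Theorems.BECGroundStateSOSPeriodicIRBoundFsumDCPotPairs
import Summits.AtomisticToContinuum.BoseEinsteinCondensation.Theorems.BECGroundStateSOSPeriodicIRBoundFsumDCKinetic
import HarnessLib

/-!
# Crux `PeriodicIRBound` (stmt-AtomisticToContinuum-3972), line `fsum-phase-pencil`, stub S3
# `stub_phaseDoubleCommutator` — potential part, R: the near/far reduction of the potential double commutator

For a core `(m+3)`-body `Ψ` and a mode `k`, the phase quadrature `U_k` is the lift of the rank-two one-body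
operator `|φ_k⟩⟨φ_0| − |φ_0⟩⟨φ_{−k}|` to all particles (`phaseUp_eq_liftOp`, part A). Split the particles into the
NEAR pair `S ∋ 0, 1` (the pair seen by the weight `w^per(x_0 − x_1)` of `pairForm`) and the FAR rest `Sᶜ`:
`U_k = A + B`, `U_{−k} = A' + B'` (`A = liftOp S k 0 0 (−k)`, `B = liftOp Sᶜ k 0 0 (−k)`, `A' = liftOp S (−k) 0 0 k`,
`B' = liftOp Sᶜ (−k) 0 0 k`). The far lifts move across the pair form as adjoints (part C, `pairForm_liftOp_far`)
and `(k, 0, 0, −k)ᵀ = (0, k, −k, 0) = −(−k, 0, 0, k)`, so `B† = −B'`, `B'† = −B` on the pair form; with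
`[A', B] = 0` (disjoint slots, `liftOp_comm`) every far term of
`pairForm(U_kΨ, U_kΨ) + pairForm(U_{−k}U_kΨ, Ψ) + (k ↔ −k)` cancels in the real part, leaving the purely NEAR
expression `Re pairForm(AΨ, AΨ) + Re pairForm(A'Ψ, A'Ψ) + Re pairForm(A'AΨ, Ψ) + Re pairForm(AA'Ψ, Ψ)`.
Multiplying by the number of pairs (part D, `potRe_eq_pairs_mul`, `toReal_potForm_eq_pairs_mul`) gives the
reduction of the potential double commutator `P[U_kΨ] + P[U_{−k}Ψ] + potRe(U_{−k}U_kΨ, Ψ) + potRe(U_kU_{−k}Ψ, Ψ)`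
to near lifts of the pair `{0, 1}` — registered helper stub `stub_fsumDCPotReduce`.
-/

noncomputable section

open MeasureTheory Filter
open scoped ENNReal NNReal ComplexConjugate BigOperators

namespace Summit.AtomisticToContinuum.BoseEinsteinCondensation.Cruxes.PeriodicIRBound.FsumPhasePencil

open Literature.MathematicalPhysics.QuantumManyBody.BoseGas
open Summit.AtomisticToContinuum.BoseEinsteinCondensation.Cruxes.PeriodicIRBound.LinearPhFloorWagner.WF

variable {N m n : ℕ} {L : ℝ}

/-! ## Operator algebra of the lifts -/

/-- Exchanging the two rank-one pieces negates the lift: `liftOp S c d a b = −liftOp S a b c d`. [folklore] -/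
theorem liftOp_rev_eq_neg (L : ℝ) (S : Finset (Fin N)) (a b c d : Fin 3 → ℤ) (F : Config N → ℂ) :
    liftOp L S c d a b F = fun X => -liftOp L S a b c d F X := by
  funext X
  simp only [liftOp, ← Finset.sum_neg_distrib, neg_sub]

/-- **Near/far splitting of the phase quadrature**: `U_kΨ = liftOp S k 0 0 (−k) Ψ + liftOp Sᶜ k 0 0 (−k) Ψ` for a
Bose-symmetric `(n+1)`-body `Ψ` and any set of particles `S`. [folklore] -/
theorem phaseUp_eq_liftOp_add_liftOp_compl (L : ℝ) (k : Fin 3 → ℤ) (S : Finset (Fin (n + 1)))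
    {Ψ : Config (n + 1) → ℂ} (hΨ : IsSymm Ψ) :
    phaseUp L k Ψ = fun X => liftOp L S k 0 0 (-k) Ψ X + liftOp L Sᶜ k 0 0 (-k) Ψ X := by
  rw [phaseUp_eq_liftOp L k hΨ, ← Finset.union_compl S, liftOp_union disjoint_compl_right]

/-! ## Far lifts across the pair form -/

section Reduce

variable {w : ℝ → ℝ≥0∞} (hL : 0 < L) (hw : Measurable w) (hint : (∫⁻ z : Space, w ‖z‖) ≠ ⊤)
include hL hw hint

/-- **`B† = −B'` on the pair form**: for `S ∌ 0, 1` and continuous `F, G`,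
`pairForm (liftOp S a b c d F) G = −pairForm F (liftOp S d c b a G)` (far-lift adjointness `pairForm_liftOp_far`
and `(a, b, c, d)ᵀ = (b, a, d, c) = −(d, c, b, a)`). [folklore] -/
theorem pairForm_liftOp_far_eq_neg {S : Finset (Fin (m + 3))} (h0 : (0 : Fin (m + 3)) ∉ S)
    (h1 : (1 : Fin (m + 3)) ∉ S) (a b c d : Fin 3 → ℤ) {F G : Config (m + 3) → ℂ} (hF : Continuous F)
    (hG : Continuous G) :
    pairForm w L (liftOp L S a b c d F) G = -pairForm w L F (liftOp L S d c b a G) := by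
  rw [pairForm_liftOp_far hL hw hint h0 h1 a b c d hF hG, liftOp_rev_eq_neg L S d c b a G]
  exact pairForm_neg_right _ _

/-! ## The near/far expansion of the four pair forms -/

/-- `pairForm (U_kΨ) G = pairForm (AΨ) G + pairForm (BΨ) G` (near/far splitting in the first argument). [folklore] -/
theorem pairForm_phaseUp_left (k : Fin 3 → ℤ) (S : Finset (Fin (m + 3))) {Ψ G : Config (m + 3) → ℂ}
    (hΨc : Continuous Ψ) (hΨs : IsSymm Ψ) (hG : Continuous G) :
    pairForm w L (phaseUp L k Ψ) G =
      pairForm w L (liftOp L S k 0 0 (-k) Ψ) G + pairForm w L (liftOp L Sᶜ k 0 0 (-k) Ψ) G := by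
  rw [phaseUp_eq_liftOp_add_liftOp_compl L k S hΨs]
  exact pairForm_add_left hL hw hint (continuous_liftOp L S k 0 0 (-k) hΨc)
    (continuous_liftOp L Sᶜ k 0 0 (-k) hΨc) hG

/-- `pairForm (U_kΨ) (U_kΨ) = pairForm (U_kΨ) (AΨ) + pairForm (U_kΨ) (BΨ)` (near/far splitting in the second
argument). [folklore] -/
theorem pairForm_phaseUp_self (k : Fin 3 → ℤ) (S : Finset (Fin (m + 3))) {Ψ : Config (m + 3) → ℂ}
    (hΨc : Continuous Ψ) (hΨs : IsSymm Ψ) :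
    pairForm w L (phaseUp L k Ψ) (phaseUp L k Ψ) =
      pairForm w L (phaseUp L k Ψ) (liftOp L S k 0 0 (-k) Ψ) +
        pairForm w L (phaseUp L k Ψ) (liftOp L Sᶜ k 0 0 (-k) Ψ) :=
  (congrArg (pairForm w L (phaseUp L k Ψ)) (phaseUp_eq_liftOp_add_liftOp_compl L k S hΨs)).trans
    (pairForm_add_right hL hw hint (continuous_phaseUp L k hΨc) (continuous_liftOp L S k 0 0 (-k) hΨc)
      (continuous_liftOp L Sᶜ k 0 0 (-k) hΨc))

/-- **A near lift of `U_kΨ` against `Ψ`**: for `S ∋ 0, 1` and a near lift `A'' = liftOp S e f g h`,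
`pairForm (A''U_kΨ) Ψ = pairForm (A''AΨ) Ψ − pairForm (A''Ψ) (B'Ψ)` (`A''B = BA''` by `liftOp_comm`, then
`B† = −B'`). [folklore] -/
theorem pairForm_liftOp_phaseUp {S : Finset (Fin (m + 3))} (h0 : (0 : Fin (m + 3)) ∈ S) (h1 : (1 : Fin (m + 3)) ∈ S)
    (e f g h k : Fin 3 → ℤ) {Ψ : Config (m + 3) → ℂ} (hΨc : Continuous Ψ) (hΨs : IsSymm Ψ) :
    pairForm w L (liftOp L S e f g h (phaseUp L k Ψ)) Ψ =
      pairForm w L (liftOp L S e f g h (liftOp L S k 0 0 (-k) Ψ)) Ψ -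
        pairForm w L (liftOp L S e f g h Ψ) (liftOp L Sᶜ (-k) 0 0 k Ψ) := by
  have h0' : (0 : Fin (m + 3)) ∉ Sᶜ := fun h' => (Finset.mem_compl.1 h') h0
  have h1' : (1 : Fin (m + 3)) ∉ Sᶜ := fun h' => (Finset.mem_compl.1 h') h1
  have hA := continuous_liftOp L S k 0 0 (-k) hΨc
  have hB := continuous_liftOp L Sᶜ k 0 0 (-k) hΨc
  have hE := continuous_liftOp L S e f g h hΨc
  rw [phaseUp_eq_liftOp_add_liftOp_compl L k S hΨs, liftOp_add hA hB,
    liftOp_comm disjoint_compl_right e f g h k 0 0 (-k) hΨc,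
    pairForm_add_left hL hw hint (continuous_liftOp L S e f g h hA) (continuous_liftOp L Sᶜ k 0 0 (-k) hE) hΨc,
    pairForm_liftOp_far_eq_neg hL hw hint h0' h1' k 0 0 (-k) hE hΨc, sub_eq_add_neg]

/-- **`U_{−k}U_kΨ` against `Ψ`**: for `S ∋ 0, 1`,
`pairForm (U_{−k}U_kΨ) Ψ = pairForm (A'U_kΨ) Ψ − pairForm (U_kΨ) (BΨ)` (`U_{−k} = A' + B'` on the symmetric `U_kΨ`,
then `B'† = −B`). [folklore] -/
theorem pairForm_phaseUp_phaseUp_left {S : Finset (Fin (m + 3))} (h0 : (0 : Fin (m + 3)) ∈ S)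
    (h1 : (1 : Fin (m + 3)) ∈ S) (k : Fin 3 → ℤ) {Ψ : Config (m + 3) → ℂ} (hΨc : Continuous Ψ) (hΨs : IsSymm Ψ) :
    pairForm w L (phaseUp L (-k) (phaseUp L k Ψ)) Ψ =
      pairForm w L (liftOp L S (-k) 0 0 k (phaseUp L k Ψ)) Ψ -
        pairForm w L (phaseUp L k Ψ) (liftOp L Sᶜ k 0 0 (-k) Ψ) := by
  have h0' : (0 : Fin (m + 3)) ∉ Sᶜ := fun h' => (Finset.mem_compl.1 h') h0
  have h1' : (1 : Fin (m + 3)) ∉ Sᶜ := fun h' => (Finset.mem_compl.1 h') h1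
  have hUc : Continuous (phaseUp L k Ψ) := continuous_phaseUp L k hΨc
  have hU := phaseUp_eq_liftOp_add_liftOp_compl L (-k) S (isSymm_phaseUp L k hΨs)
  rw [neg_neg] at hU
  rw [hU, pairForm_add_left hL hw hint (continuous_liftOp L S (-k) 0 0 k hUc)
      (continuous_liftOp L Sᶜ (-k) 0 0 k hUc) hΨc,
    pairForm_liftOp_far_eq_neg hL hw hint h0' h1' (-k) 0 0 k hUc hΨc, sub_eq_add_neg]

/-- **Half of the reduction** (before real parts): for `S ∋ 0, 1`,
`pairForm (U_kΨ) (U_kΨ) + pairForm (U_{−k}U_kΨ) Ψ = pairForm (AΨ) (AΨ) + pairForm (BΨ) (AΨ) + pairForm (A'AΨ) Ψ −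
pairForm (A'Ψ) (B'Ψ)` (the two `pairForm (U_kΨ) (BΨ)` cancel). [folklore] -/
theorem pairForm_phaseUp_half {S : Finset (Fin (m + 3))} (h0 : (0 : Fin (m + 3)) ∈ S) (h1 : (1 : Fin (m + 3)) ∈ S)
    (k : Fin 3 → ℤ) {Ψ : Config (m + 3) → ℂ} (hΨc : Continuous Ψ) (hΨs : IsSymm Ψ) :
    pairForm w L (phaseUp L k Ψ) (phaseUp L k Ψ) + pairForm w L (phaseUp L (-k) (phaseUp L k Ψ)) Ψ =
      pairForm w L (liftOp L S k 0 0 (-k) Ψ) (liftOp L S k 0 0 (-k) Ψ) +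
        pairForm w L (liftOp L Sᶜ k 0 0 (-k) Ψ) (liftOp L S k 0 0 (-k) Ψ) +
        pairForm w L (liftOp L S (-k) 0 0 k (liftOp L S k 0 0 (-k) Ψ)) Ψ -
        pairForm w L (liftOp L S (-k) 0 0 k Ψ) (liftOp L Sᶜ (-k) 0 0 k Ψ) := by
  rw [pairForm_phaseUp_phaseUp_left hL hw hint h0 h1 k hΨc hΨs, pairForm_phaseUp_self hL hw hint k S hΨc hΨs,
    pairForm_liftOp_phaseUp hL hw hint h0 h1 (-k) 0 0 k k hΨc hΨs,
    pairForm_phaseUp_left hL hw hint k S hΨc hΨs (continuous_liftOp L S k 0 0 (-k) hΨc)]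
  ring

/-- **The near/far reduction in the real part**: for `S ∋ 0, 1` and a continuous Bose-symmetric `Ψ`,
`Re pairForm (U_kΨ) (U_kΨ) + Re pairForm (U_{−k}Ψ) (U_{−k}Ψ) + Re pairForm (U_{−k}U_kΨ) Ψ + Re pairForm (U_kU_{−k}Ψ) Ψ
 = Re pairForm (AΨ) (AΨ) + Re pairForm (A'Ψ) (A'Ψ) + Re pairForm (A'AΨ) Ψ + Re pairForm (AA'Ψ) Ψ`
(the two halves `k`, `−k`; the far brackets cancel by `Re pairForm F G = Re pairForm G F`). [folklore] -/
theorem pairForm_doubleCommutator_re {S : Finset (Fin (m + 3))} (h0 : (0 : Fin (m + 3)) ∈ S)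
    (h1 : (1 : Fin (m + 3)) ∈ S) (k : Fin 3 → ℤ) {Ψ : Config (m + 3) → ℂ} (hΨc : Continuous Ψ) (hΨs : IsSymm Ψ) :
    (pairForm w L (phaseUp L k Ψ) (phaseUp L k Ψ)).re + (pairForm w L (phaseUp L (-k) Ψ) (phaseUp L (-k) Ψ)).re +
        (pairForm w L (phaseUp L (-k) (phaseUp L k Ψ)) Ψ).re + (pairForm w L (phaseUp L k (phaseUp L (-k) Ψ)) Ψ).re =
      (pairForm w L (liftOp L S k 0 0 (-k) Ψ) (liftOp L S k 0 0 (-k) Ψ)).re +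
        (pairForm w L (liftOp L S (-k) 0 0 k Ψ) (liftOp L S (-k) 0 0 k Ψ)).re +
        (pairForm w L (liftOp L S (-k) 0 0 k (liftOp L S k 0 0 (-k) Ψ)) Ψ).re +
        (pairForm w L (liftOp L S k 0 0 (-k) (liftOp L S (-k) 0 0 k Ψ)) Ψ).re := by
  have e1 := congrArg Complex.re (pairForm_phaseUp_half hL hw hint h0 h1 k hΨc hΨs)
  have e2 := congrArg Complex.re (pairForm_phaseUp_half hL hw hint h0 h1 (-k) hΨc hΨs)
  simp only [neg_neg, Complex.add_re, Complex.sub_re] at e1 e2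
  linear_combination e1 + e2 +
    pairForm_re_comm (w := w) (liftOp L Sᶜ k 0 0 (-k) Ψ) (liftOp L S k 0 0 (-k) Ψ) +
    pairForm_re_comm (w := w) (liftOp L Sᶜ (-k) 0 0 k Ψ) (liftOp L S (-k) 0 0 k Ψ)

/-! ## The reduction of the potential double commutator -/

/-- **The near/far reduction of the potential double commutator**: for a core `(m+3)`-body `Ψ`, a mode `k` and a
set of particles `S ∋ 0, 1`,
`P[U_kΨ] + P[U_{−k}Ψ] + potRe(U_{−k}U_kΨ, Ψ) + potRe(U_kU_{−k}Ψ, Ψ)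
 = (m+3)(m+2)/2 · (Re pairForm (AΨ) (AΨ) + Re pairForm (A'Ψ) (A'Ψ) + Re pairForm (A'AΨ) Ψ + Re pairForm (AA'Ψ) Ψ)`
with the near lifts `A = liftOp S k 0 0 (−k)`, `A' = liftOp S (−k) 0 0 k` (pair reduction `potRe_eq_pairs_mul`,
`toReal_potForm_eq_pairs_mul`, then `pairForm_doubleCommutator_re`). [folklore] -/
theorem potential_doubleCommutator_reduce {S : Finset (Fin (m + 3))} (h0 : (0 : Fin (m + 3)) ∈ S)
    (h1 : (1 : Fin (m + 3)) ∈ S) (k : Fin 3 → ℤ) {Ψ : Config (m + 3) → ℂ} (hΨ : IsCore L Ψ) :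
    (potForm w L (phaseUp L k Ψ)).toReal + (potForm w L (phaseUp L (-k) Ψ)).toReal +
        potRe w L (phaseUp L (-k) (phaseUp L k Ψ)) Ψ + potRe w L (phaseUp L k (phaseUp L (-k) Ψ)) Ψ =
      ((m + 3) * (m + 2) / 2 : ℝ) *
        ((pairForm w L (liftOp L S k 0 0 (-k) Ψ) (liftOp L S k 0 0 (-k) Ψ)).re +
          (pairForm w L (liftOp L S (-k) 0 0 k Ψ) (liftOp L S (-k) 0 0 k Ψ)).re +
          (pairForm w L (liftOp L S (-k) 0 0 k (liftOp L S k 0 0 (-k) Ψ)) Ψ).re +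
          (pairForm w L (liftOp L S k 0 0 (-k) (liftOp L S (-k) 0 0 k Ψ)) Ψ).re) := by
  have hΨc : Continuous Ψ := hΨ.contDiff.continuous
  have hΨs : IsSymm Ψ := hΨ.symm
  have hUc : Continuous (phaseUp L k Ψ) := continuous_phaseUp L k hΨc
  have hUs : IsSymm (phaseUp L k Ψ) := isSymm_phaseUp L k hΨs
  have hU'c : Continuous (phaseUp L (-k) Ψ) := continuous_phaseUp L (-k) hΨc
  have hU's : IsSymm (phaseUp L (-k) Ψ) := isSymm_phaseUp L (-k) hΨs
  rw [toReal_potForm_eq_pairs_mul hL hw hint hUc hUs, toReal_potForm_eq_pairs_mul hL hw hint hU'c hU's,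
    potRe_eq_pairs_mul hL hw hint (continuous_phaseUp L (-k) hUc) hΨc (isSymm_phaseUp L (-k) hUs) hΨs,
    potRe_eq_pairs_mul hL hw hint (continuous_phaseUp L k hU'c) hΨc (isSymm_phaseUp L k hU's) hΨs]
  push_cast
  linear_combination ((m : ℝ) + 3) * ((m : ℝ) + 2) / 2 * pairForm_doubleCommutator_re hL hw hint h0 h1 k hΨc hΨs

end Reduce

/-! ## Registered headline -/

/-- **Registered helper stub `stub_fsumDCPotReduce`** (line `fsum-phase-pencil`, S3 potential part R): the near/far
reduction of the potential double commutator to the near lifts of the pair `{0, 1}`,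
`potential_doubleCommutator_reduce` (the far-lift adjointness and the pair reduction it is stated under are the
landed parts C and D, `pairForm_liftOp_far` and `potRe_eq_pairs_mul`/`toReal_potForm_eq_pairs_mul`). [folklore] -/
theorem stub_fsumDCPotReduce : (∀ {m : ℕ} {L : ℝ} {w : ℝ → ℝ≥0∞}, 0 < L → Measurable w → (∫⁻ z : Space, w ‖z‖) ≠ ⊤ → ∀ {S : Finset (Fin (m + 3))}, (0 : Fin (m + 3)) ∉ S → (1 : Fin (m + 3)) ∉ S → ∀ (a b c d : Fin 3 → ℤ) {F G : Config (m + 3) → ℂ}, Continuous F → Continuous G → pairForm w L (liftOp L S a b c d F) G = pairForm w L F (liftOp L S b a d c G)) → (∀ {m : ℕ} {L : ℝ} {w : ℝ → ℝ≥0∞}, 0 < L → Measurable w → (∫⁻ z : Space, w ‖z‖) ≠ ⊤ → ∀ {f g : Config (m + 2) → ℂ}, Continuous f → Continuous g → IsSymm f → IsSymm g → potRe w L f g = ((m + 2) * (m + 1) / 2 : ℝ) * (pairForm w L f g).re ∧ (potForm w L f).toReal = ((m + 2) * (m + 1) / 2 : ℝ) * (pairForm w L f f).re) → (∀ {m : ℕ}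 {L : ℝ} {w : ℝ → ℝ≥0∞}, 0 < L → Measurable w → (∫⁻ z : Space, w ‖z‖) ≠ ⊤ → ∀ (k : Fin 3 → ℤ) {Ψ : Config (m + 3) → ℂ}, IsCore L Ψ → (potForm w L (phaseUp L k Ψ)).toReal + (potForm w L (phaseUp L (-k) Ψ)).toReal + potRe w L (phaseUp L (-k) (phaseUp L k Ψ)) Ψ + potRe w L (phaseUp L k (phaseUp L (-k) Ψ)) Ψ = ((m + 3) * (m + 2) / 2 : ℝ) * ((pairForm w L (liftOp L ({0, 1} : Finset (Fin (m + 3))) k 0 0 (-k) Ψ) (liftOp L ({0, 1} : Finset (Fin (m + 3))) k 0 0 (-k) Ψ)).re + (pairForm w L (liftOp L ({0, 1} : Finset (Fin (m + 3))) (-k) 0 0 k Ψ) (liftOp L ({0, 1} : Finset (Fin (m + 3))) (-k) 0 0 k Ψ)).re + (pairForm w L (liftOp L ({0, 1} : Finset (Fin (m + 3))) (-k) 0 0 k (liftOp L ({0, 1} : Finset (Fin (m + 3))) k 0 0 (-k) Ψ)) Ψ).re + (pairForm w L (liftOp L ({0, 1} : Finset (Fin (m + 3))) k 0 0 (-k)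 (liftOp L ({0, 1} : Finset (Fin (m + 3))) (-k) 0 0 k Ψ)) Ψ).re)) := by
  intro _ _ m L w hL hw hint k Ψ hΨ
  exact potential_doubleCommutator_reduce hL hw hint (Finset.mem_insert_self 0 {1})
    (Finset.mem_insert_of_mem (Finset.mem_singleton_self 1)) k hΨ

end Summit.AtomisticToContinuum.BoseEinsteinCondensation.Cruxes.PeriodicIRBound.FsumPhasePencil

end
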